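import Summits.Schanuel.Schanuel.Theorems.DiophantineDichotomyApproximationPropertyResiduals
import Literature.NumberTheory.Transcendental.PhilipponCriterionProjDist
import Mathlib.NumberTheory.Height.NumberField
import HarnessLib

/-!
# Stubs `pointAPAbsAt_of_AP2`, `approximationProperty_of_AP2` of line `orbit-interpolation-determinant` (stmt-Schanuel-6117)

Route `DiophantineDichotomy`, crux
`Summit.Schanuel.Schanuel.Theses.DiophantineDichotomy.ApproximationProperty`, line
`orbit-interpolation-determinant` (vocabulary in
`Theorems/DiophantineDichotomyApproximationPropertyDefs.lean`). The currency bridge from Philippon's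
PRINTED Approximation Property 2 — projective, with a constant `c = c(n)` uniform in the point
`x ∈ ℙⁿ(ℂ)`, closeness measured by Nesterenko's projective distance `projDist` and heights by the
`K`-relative Weil height `Height.logHeight` — to the line's affine point property `PointAPAbsAt t`
(sup-norm polydisc around `ω ∈ ℂᵗ`, point `(1 : β)`), and from there to the crux through the proved
residual reduction `approximationProperty_of_pointAP_three_le`.

The conversion is elementary: apply AP2 at `x = (1, ω)`, `H = Y` (the side condition
`c log(Δ + 1) ≤ Y` holds once `Δ ≥ 2c² + 1`, by `Δ + 1 ≤ (Δ/c)²/2 ≤ e^{Δ/c}`); the approximating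
algebraic point `σ(α)` is projectively `e^{−X/c}`-close with `X = Δ h(α) + Y [K:ℚ] ≥ C`, hence (for
`C ≥ 2c log(2Θ²)`, `Θ = |(1, ω)|`) affine (`α₀ ≠ 0`, `PhilipponMain.affine_near_of_projDist_le`) and
`β = (α₁/α₀, …, α_t/α₀)` is `2Θ² e^{−X/c} ≤ e^{−X/C}`-close to `ω` in the sup norm, with
`h(1 : β) = h(α)` by projective invariance of the height.

Sources: NesterenkoPhilippon2001 (LNM 1752) Ch. 4 §4 p. 61 (AP1/AP2); Philippon 1986 (Publ. Math.
IHÉS 64) Lemme 1.16; LaurentRoy1999.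
-/

set_option linter.dupNamespace false

namespace Summit.Schanuel.Schanuel.Cruxes.ApproximationProperty.OrbitInterpolationDeterminant

open Summit.Schanuel.Schanuel.Theses.DiophantineDichotomy
open Literature.NumberTheory.Transcendental Literature.NumberTheory.Transcendental.Nesterenko

noncomputable section

/-- Accuracy bookkeeping: if `C ≥ 2c`, `C ≥ 2c log(2Θ²)` and `X ≥ C` then
`2Θ² e^{−X/c} ≤ e^{−X/C}` and `e^{−X/c} Θ ≤ 1/2`. [folklore] -/
-- adapted from `accuracy_le` in `Theorems/DiophantineDichotomyApproximationPropertyPointAP.lean`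
private theorem accuracy_le_of_two_mul_le {Θ X c C : ℝ} (hΘ : 1 ≤ Θ) (hc : 0 < c)
    (hC1 : 2 * c ≤ C) (hC2 : 2 * c * Real.log (2 * Θ ^ 2) ≤ C) (hX : C ≤ X) :
    2 * Θ ^ 2 * Real.exp (-(X / c)) ≤ Real.exp (-(X / C)) ∧
      Real.exp (-(X / c)) * Θ ≤ 1 / 2 := by
  have hC0 : 0 < C := by linarith
  have hX0 : 0 < X := lt_of_lt_of_le hC0 hX
  have hΘ2 : 1 ≤ 2 * Θ ^ 2 := by nlinarith
  have h1 : X / C ≤ X / (2 * c) := div_le_div_of_nonneg_left hX0.le (by positivity) hC1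
  have h2 : Real.log (2 * Θ ^ 2) ≤ X / (2 * c) := by
    rw [le_div_iff₀ (by positivity)]
    nlinarith
  have h3 : X / (2 * c) + X / (2 * c) = X / c := by
    field_simp
    ring
  refine ⟨?_, ?_⟩
  · rw [← Real.exp_log (by positivity : (0 : ℝ) < 2 * Θ ^ 2), ← Real.exp_add, Real.exp_le_exp]
    linarith
  · have h4 : Real.log (2 * Θ) ≤ X / c := by
      have e1 : Real.log (2 * Θ) ≤ Real.log (2 * Θ ^ 2) :=
        Real.log_le_log (by positivity) (by nlinarith)
      have e2 : X / (2 * c) ≤ X / c := div_le_div_of_nonneg_left hX0.le hc (by linarith)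
      linarith
    have h5 : Real.exp (-(X / c)) ≤ (2 * Θ)⁻¹ := by
      rw [← Real.exp_log (by positivity : (0 : ℝ) < 2 * Θ), ← Real.exp_neg, Real.exp_le_exp]
      linarith
    calc Real.exp (-(X / c)) * Θ ≤ (2 * Θ)⁻¹ * Θ :=
          mul_le_mul_of_nonneg_right h5 (by positivity)
      _ = 1 / 2 := by field_simp

/-- The side condition of AP2 at `H = Y ≥ Δ`: `c log(Δ + 1) ≤ Δ` once `Δ ≥ 2c² + 1` (`c > 0`),
since `Δ + 1 ≤ (Δ/c)²/2 ≤ e^{Δ/c}`. [folklore] -/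
private theorem mul_log_add_one_le {c Δ : ℝ} (hc : 0 < c) (hΔ : 2 * c ^ 2 + 1 ≤ Δ) :
    c * Real.log (Δ + 1) ≤ Δ := by
  have hΔ0 : 0 ≤ Δ := by nlinarith
  have e1 : Δ + 1 ≤ (Δ / c) ^ 2 / 2 := by
    rw [div_pow, div_div, le_div_iff₀ (by positivity)]
    nlinarith [mul_nonneg (sub_nonneg.mpr hΔ) hΔ0]
  have e2 : (Δ / c) ^ 2 / 2 ≤ Real.exp (Δ / c) := by
    have h1 := Real.quadratic_le_exp_of_nonneg (x := Δ / c) (by positivity)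
    have h2 : 0 ≤ Δ / c := by positivity
    linarith
  have e3 : Real.log (Δ + 1) ≤ Δ / c :=
    (Real.log_le_iff_le_exp (by linarith)).mpr (e1.trans e2)
  have e4 : c * (Δ / c) = Δ := by field_simp
  calc c * Real.log (Δ + 1) ≤ c * (Δ / c) := mul_le_mul_of_nonneg_left e3 hc.le
    _ = Δ := e4

/-- **Philippon's printed AP2 ⇒ the affine point property `PointAPAbsAt t`** (`t ≥ 1`).
Philippon's Approximation Property 2 in transcendence degree `t` — for every non-zero
`x ∈ ℂ^{t+1}` and all `Δ ≥ c`, `H ≥ c log(Δ + 1)` an algebraic point `α ∈ K^{t+1} ∖ 0` of a number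
field `K` with `[K:ℚ] ≤ (cΔ)ᵗ`, `h_K(α) ≤ cᵗ H Δ^{t−1}` and projective distance
`‖x − σ(α)‖ ≤ exp(−(Δ h_K(α) + H [K:ℚ])/c)` for some embedding `σ : K → ℂ` — implies the line's
affine point property at every `ω ∈ ℂᵗ`: apply it at `x = (1, ω)`, `H = Y`, normalise the close
projective point to `(1 : β)` (`PhilipponMain.affine_near_of_projDist_le`; the height is
projectively invariant) and absorb the factor `2|(1, ω)|²` of the passage to the sup norm into the
constant. [cite: NesterenkoPhilippon2001, Ch. 4 §4 p. 61] -/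
theorem pointAPAbsAt_of_AP2 : ∀ t : ℕ, 1 ≤ t → (∃ c : ℝ, 1 ≤ c ∧ ∀ (x : Fin (t + 1) → ℂ), x ≠ 0 → ∀ Δ H : ℝ, c ≤ Δ → c * Real.log (Δ + 1) ≤ H → ∃ (K : Type) (_ : Field K) (_ : NumberField K) (α : Fin (t + 1) → K) (σ : K →+* ℂ), α ≠ 0 ∧ (Module.finrank ℚ K : ℝ) ≤ (c * Δ) ^ t ∧ Height.logHeight α ≤ c ^ t * H * Δ ^ (t - 1) ∧ projDist x (fun j => σ (α j)) ≤ Real.exp (-((Height.logHeight α * Δ + Module.finrank ℚ K * H) / c))) → PointAPAbsAt t := by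
  intro t ht hAP2 ω
  obtain ⟨c, hc1, hAP⟩ := hAP2
  -- the point `x = (1, ω)` and `Θ = |x| ≥ 1`
  set x : Fin (t + 1) → ℂ := Fin.cons 1 ω with hxdef
  set Θ : ℝ := ‖x‖ with hΘdef
  have hΘ1 : 1 ≤ Θ := PhilipponMain.one_le_norm_cons_one ω
  have hx0 : x ≠ 0 := PhilipponMain.cons_one_ne_zero ω
  have hc0 : 0 < c := by linarith
  have hΘ2 : 1 ≤ 2 * Θ ^ 2 := by nlinarith
  have hlog0 : 0 ≤ Real.log (2 * Θ ^ 2) := Real.log_nonneg hΘ2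
  have hct : c ≤ c ^ t := le_self_pow₀ hc1 (by omega)
  have hcsq : c ≤ c ^ 2 := by nlinarith
  -- the output constant
  set C : ℝ := 2 * c ^ 2 + 1 + c ^ t + 2 * c * Real.log (2 * Θ ^ 2) with hCdef
  have hClog0 : 0 ≤ 2 * c * Real.log (2 * Θ ^ 2) := by positivity
  have hct0 : 0 ≤ c ^ t := by positivity
  have hCc : c ≤ C := by nlinarith
  have hC1 : 1 ≤ C := hc1.trans hCc
  have hC2c : 2 * c ≤ C := by nlinarith
  have hClog : 2 * c * Real.log (2 * Θ ^ 2) ≤ C := by nlinarith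
  have hCsq : 2 * c ^ 2 + 1 ≤ C := by linarith
  have hCt : c ^ t ≤ C := by nlinarith
  refine ⟨C, hC1, fun Δ Y hΔ hY => ?_⟩
  have hΔc : c ≤ Δ := hCc.trans hΔ
  have hΔ0 : 0 ≤ Δ := by linarith
  have hY0 : 0 ≤ Y := by linarith
  -- the side condition `c log(Δ + 1) ≤ Y`
  have hlogY : c * Real.log (Δ + 1) ≤ Y := (mul_log_add_one_le hc0 (hCsq.trans hΔ)).trans hY
  -- Philippon's AP2 at `x = (1, ω)`, `H = Y`
  obtain ⟨K, _instF, _instNF, α, σ, hα0, hd, hh, hdist⟩ := hAP x hx0 Δ Y hΔc hlogY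
  set β' : Fin (t + 1) → ℂ := fun j => σ (α j) with hβ'def
  have hβ'0 : β' ≠ 0 := by
    intro h
    apply hα0
    funext i
    have hi := congrFun h i
    simpa [hβ'def] using hi
  -- the exponent `X = Δ h(α) + Y [K:ℚ] ≥ C`
  set X : ℝ := Height.logHeight α * Δ + Module.finrank ℚ K * Y with hXdef
  have hfin1 : (1 : ℝ) ≤ Module.finrank ℚ K := by
    have h := (Module.finrank_pos : 0 < Module.finrank ℚ K)
    exact_mod_cast h
  have hhα0 : 0 ≤ Height.logHeight α := Height.logHeight_nonneg α
  have hXC : C ≤ X := by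
    have e1 : Y ≤ Module.finrank ℚ K * Y := le_mul_of_one_le_left hY0 hfin1
    have e2 : 0 ≤ Height.logHeight α * Δ := by positivity
    linarith
  obtain ⟨hacc, hhalf⟩ := accuracy_le_of_two_mul_le hΘ1 hc0 hC2c hClog hXC
  have hρ : projDist x β' ≤ Real.exp (-(X / c)) := hdist
  -- the close projective point is affine-near
  obtain ⟨hβ0, -, hnear⟩ := PhilipponMain.affine_near_of_projDist_le ω hβ'0
    ((mul_le_mul_of_nonneg_right hρ (by positivity)).trans hhalf)
  have hα00 : α 0 ≠ 0 := fun h => hβ0 (by simp [hβ'def, h])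
  -- the output point `β = (α₁/α₀, …, α_t/α₀)`
  set β : Fin t → K := fun j => α j.succ / α 0 with hβdef
  have hσβ : ∀ j : Fin t, σ (β j) = β' j.succ / β' 0 := fun j => by
    simp [hβdef, hβ'def, map_div₀]
  have hcons : (Fin.cons (1 : K) β : Fin (t + 1) → K) = (α 0)⁻¹ • α := by
    funext i
    refine Fin.cases ?_ (fun j => ?_) i
    · simp [hα00]
    · simp [hβdef, div_eq_inv_mul]
  have hheight : Height.logHeight (Fin.cons (1 : K) β : Fin (t + 1) → K) = Height.logHeight α := by
    rw [hcons, Height.logHeight_smul_eq_logHeight _ (inv_ne_zero hα00)]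
  refine ⟨K, _instF, _instNF, β, σ, ?_, ?_, ?_⟩
  · -- degree budget
    exact hd.trans (pow_le_pow_left₀ (by positivity) (mul_le_mul_of_nonneg_right hCc hΔ0) t)
  · -- height budget
    rw [hheight]
    refine hh.trans ?_
    have h0 : 0 ≤ Y * Δ ^ (t - 1) := by positivity
    calc c ^ t * Y * Δ ^ (t - 1) = c ^ t * (Y * Δ ^ (t - 1)) := by ring
      _ ≤ C * (Y * Δ ^ (t - 1)) := mul_le_mul_of_nonneg_right hCt h0
      _ = C * Y * Δ ^ (t - 1) := by ring
  · -- accuracy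
    have hsup : ‖(fun j => σ (β j)) - ω‖ ≤ 2 * Θ ^ 2 * projDist x β' := by
      refine (pi_norm_le_iff_of_nonneg
        (mul_nonneg (by positivity) (projDist_nonneg _ _))).mpr fun j => ?_
      simp only [Pi.sub_apply, hσβ]
      exact hnear j
    calc ‖(fun j => σ (β j)) - ω‖ ≤ 2 * Θ ^ 2 * projDist x β' := hsup
      _ ≤ 2 * Θ ^ 2 * Real.exp (-(X / c)) := mul_le_mul_of_nonneg_left hρ (by positivity)
      _ ≤ Real.exp (-(X / C)) := hacc
      _ = _ := by rw [hheight, hXdef]; congr 1; ring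

/-- **Philippon's printed AP2 (all `n ≥ 3`) ⇒ the crux `ApproximationProperty`.** The currency
bridge `pointAPAbsAt_of_AP2` composed with the proved residual reduction
`approximationProperty_of_pointAP_three_le` (slices `t = 1, 2` are proved unconditionally; the
slices `t ≥ 3` follow from the point property by the lifting chain of the line).
[cite: NesterenkoPhilippon2001, Ch. 4 §4 p. 61] -/
theorem approximationProperty_of_AP2 : (∀ n : ℕ, 3 ≤ n → ∃ c : ℝ, 1 ≤ c ∧ ∀ (x : Fin (n + 1) → ℂ), x ≠ 0 → ∀ Δ H : ℝ, c ≤ Δ → c * Real.log (Δ + 1) ≤ H → ∃ (K : Type) (_ : Field K) (_ : NumberField K) (α : Fin (n + 1) → K) (σ : K →+* ℂ), α ≠ 0 ∧ (Module.finrank ℚ K : ℝ) ≤ (c * Δ) ^ n ∧ Height.logHeight α ≤ c ^ n * H * Δ ^ (n - 1) ∧ projDist x (fun j => σ (α j)) ≤ Real.exp (-((Height.logHeight α * Δ + Module.finrank ℚ K * H) / c))) → ApproximationProperty := by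
  intro h
  exact approximationProperty_of_pointAP_three_le fun t ht => pointAPAbsAt_of_AP2 t (by omega) (h t ht)

end

end Summit.Schanuel.Schanuel.Cruxes.ApproximationProperty.OrbitInterpolationDeterminant
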